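import Mathlib
import Summits.ValiantsHypothesis.ValiantsHypothesis.Theorems.BarrierLeverPartitionMinorsHitByVPHiddenStatesFullJoinCubeCore

/-!
# Route BarrierLever — item `PartitionMinorsHitByVP` (stmt-ValiantsHypothesis-19717), line `hidden_states`:
# CUBE-CORE DOOR — every layout whose two families SHATTER an `m`-set, `r = 2^m + F`, `m + F ≤ h³`, is hit in `SmallCircuits ℂ (h+h) 8`

Helper file (`--supports stmt-ValiantsHypothesis-19717`; cell valiant-natproofs, rung V4, 𝒟-side door (c), line
`Cruxes/PartitionMinorsHitByVP/Lines/hidden_states.lean` v9; prover seat val-np-p3 gen 17). Definition-free; closes NO item.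

The two-sided consequence of `…FullJoinCubeCore` (p685295): rows AND columns use the SAME cube-core design (`cubeCoreDesign m F`,
strict threshold weights `cubeCoreWt`, `K = m + F` states) with their own explicit tables (`exists_table_cubeCore`); the design's
extremal weight monomial isolates `det A · det B ≠ 0` in the one-cube full hidden sum (`fullJoin_det_ne_zero_of_threshold`, p672458),
and the one-cube door (`partitionMinor_hit_of_fullJoin_mem`) lands the witness in `SmallCircuits ℂ (h + h) 8`.

* `partitionMinor_hit_of_shatters` — for `3 ≤ h`, `m + F ≤ h³` and ANY two injective families `u, w` of `2^m + F` subsets of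
  `Fin h` (lower or not) that each SHATTER some `m`-set, the partition minor `[u, w]` is hit inside `SmallCircuits ℂ (h+h) 8`.
  For DOWN-SETS «shatters an `m`-set `A`» is just «`A` is a member», so this is an unconditional all-`h` family of hit minors in
  the EXPONENTIAL range: every pair of down-sets of size `r` each having a member of size `⌈log₂(r − h³)⌉`… precisely of size `m` with
  `r − 2^m ≤ h³ − m` («a cube plus polynomially many sets» on each side, unrelated to each other) — `partitionMinor_hit_of_mem_lower`.
* `partitionMinor_hit_cubeCore_of_card` — by Sauer–Shelah (`exists_shatters_of_card_gt`), every layout of size `2^m + F > Σ_{i<m} C(h,i)`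
  with `m + F ≤ h³` is hit (polynomial range; for `m = 0, 2` this re-derives `r ≤ h³ + 2`).

HONEST RANGE: the shattering hypothesis is a VC-dimension condition (`vcDim ≥ log₂(r − h³)`); the generic pair of down-sets in the middle
range does not satisfy it. Item 19717 stays OPEN; nothing on crux 14610 or VP ≠ VNP.
-/

set_option linter.dupNamespace false

namespace Summit.ValiantsHypothesis.ValiantsHypothesis.Theorems.BarrierLever.HiddenStates

open Finset Matrix
open Literature.Barriers.ValiantsHypothesis

noncomputable section

namespace FullJoin

variable {h : ℕ}

/-- **CUBE-CORE DOOR.** Two injective families of `2^m + F` subsets of `Fin h` that each shatter an `m`-set give a partition minor hit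
inside `SmallCircuits ℂ (h + h) 8` (`3 ≤ h`, `m + F ≤ h³`). -/
theorem partitionMinor_hit_of_shatters {m F : ℕ} (hh : 3 ≤ h) (hK : m + F ≤ h * h * h)
    (u w : Fin (2 ^ m + F) → Finset (Fin h)) (hu : Function.Injective u) (hw : Function.Injective w)
    (A B : Finset (Fin h)) (hA : #A = m) (hB : #B = m)
    (hsu : (Finset.univ.image u).Shatters A) (hsw : (Finset.univ.image w).Shatters B) :
    ∃ f ∈ SmallCircuits ℂ (h + h) 8,
      (Matrix.of fun i j : Fin (2 ^ m + F) => MvPolynomial.coeff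
        (∑ a ∈ u i, Finsupp.single (Fin.castAdd h a) 1 +
          ∑ c ∈ w j, Finsupp.single (Fin.natAdd h c) 1) f).det ≠ 0 := by
  classical
  have hh0 : 0 < h := by omega
  obtain ⟨tx, hx⟩ := exists_table_cubeCore hh0 u hu A hA hsu
  obtain ⟨ty, hy⟩ := exists_table_cubeCore hh0 w hw B hB hsw
  have hJinj : Function.Injective (cubeCoreDesign m F) := cubeCoreDesign_injective m F
  have hthr : ∀ J' : Finset (Fin (m + F)), J' ∉ Set.range (cubeCoreDesign m F) →
      ∀ k : Fin (2 ^ m + F), ∑ q ∈ cubeCoreDesign m F k, cubeCoreWt m F q < ∑ q ∈ J', cubeCoreWt m F q :=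
    cubeCoreDesign_threshold m F
  -- one piece, offset 0
  have hthr' : ∀ x : Fin 1 × Finset (Fin (m + F)),
      x ∉ Set.range (fun k : Fin (2 ^ m + F) => ((0 : Fin 1), cubeCoreDesign m F k)) →
      ∀ i : Fin (2 ^ m + F),
        (fun _ : Fin 1 => (0 : ℕ)) ((fun k : Fin (2 ^ m + F) => ((0 : Fin 1), cubeCoreDesign m F k)) i).1 +
          ∑ q ∈ ((fun k : Fin (2 ^ m + F) => ((0 : Fin 1), cubeCoreDesign m F k)) i).2,
            (fun (_ : Fin 1) (q : Fin (m + F)) => cubeCoreWt m F q)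
              ((fun k : Fin (2 ^ m + F) => ((0 : Fin 1), cubeCoreDesign m F k)) i).1 q <
        (fun _ : Fin 1 => (0 : ℕ)) x.1 + ∑ q ∈ x.2, (fun (_ : Fin 1) (q : Fin (m + F)) => cubeCoreWt m F q) x.1 q := by
    intro x hx' i
    have hx2 : x.2 ∉ Set.range (cubeCoreDesign m F) := by
      rintro ⟨k, hk⟩
      apply hx'
      refine ⟨k, ?_⟩
      ext
      · simp [Subsingleton.elim x.1 0]
      · simp [hk]
    simpa using hthr x.2 hx2 i
  have he : Function.Injective (fun k : Fin (2 ^ m + F) => ((0 : Fin 1), cubeCoreDesign m F k)) :=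
    fun k k' hkk' => hJinj (by simpa using hkk')
  obtain ⟨t₀, hdet⟩ := fullJoin_det_ne_zero_of_threshold h 1 (m + F) (2 ^ m + F) u w
    (fun k => ((0 : Fin 1), cubeCoreDesign m F k)) he (fun _ => 0)
    (fun _ q => cubeCoreWt m F q) hthr' (fun _ => tx) (fun _ => ty) (by simpa using hx) (by simpa using hy)
  refine partitionMinor_hit_of_fullJoin_mem h 1 (m + F) (2 ^ m + F) hh (by omega) hK u w (fun _ => tx) (fun _ => ty)
    (fun p => t₀ ^ (0 : ℕ)) (fun _ q => t₀ ^ cubeCoreWt m F q) ?_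
  simpa using hdet

/-- For a DOWN-SET, shattering `A` is membership of `A`. -/
theorem shatters_of_mem_lower {r : ℕ} (u : Fin r → Finset (Fin h)) (hlu : IsLowerSet (Set.range u))
    (A : Finset (Fin h)) (hA : A ∈ Set.range u) : (Finset.univ.image u).Shatters A := by
  classical
  intro t ht
  obtain ⟨i, hi⟩ := hlu ht hA
  exact ⟨u i, Finset.mem_image.mpr ⟨i, Finset.mem_univ _, rfl⟩, by rw [hi, Finset.inter_eq_right.mpr ht]⟩

/-- **Down-set form: «a cube plus polynomially many sets» on each side.** Two injective LOWER families of `2^m + F` subsets of `Fin h`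
(`3 ≤ h`, `m + F ≤ h³`), each having SOME member of size `m`, give a partition minor hit inside `SmallCircuits ℂ (h + h) 8`. -/
theorem partitionMinor_hit_of_mem_lower {m F : ℕ} (hh : 3 ≤ h) (hK : m + F ≤ h * h * h)
    (u w : Fin (2 ^ m + F) → Finset (Fin h)) (hu : Function.Injective u) (hw : Function.Injective w)
    (hlu : IsLowerSet (Set.range u)) (hlw : IsLowerSet (Set.range w))
    (A B : Finset (Fin h)) (hA : #A = m) (hB : #B = m) (hAu : A ∈ Set.range u) (hBw : B ∈ Set.range w) :
    ∃ f ∈ SmallCircuits ℂ (h + h) 8,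
      (Matrix.of fun i j : Fin (2 ^ m + F) => MvPolynomial.coeff
        (∑ a ∈ u i, Finsupp.single (Fin.castAdd h a) 1 +
          ∑ c ∈ w j, Finsupp.single (Fin.natAdd h c) 1) f).det ≠ 0 :=
  partitionMinor_hit_of_shatters hh hK u w hu hw A B hA hB (shatters_of_mem_lower u hlu A hAu)
    (shatters_of_mem_lower w hlw B hBw)

/-- **By Sauer–Shelah**: every layout of size `2^m + F > Σ_{i<m} C(h,i)` with `m + F ≤ h³` (`3 ≤ h`) is hit inside
`SmallCircuits ℂ (h + h) 8`. -/
theorem partitionMinor_hit_cubeCore_of_card {m F : ℕ} (hh : 3 ≤ h) (hK : m + F ≤ h * h * h)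
    (hr : ∑ i ∈ Finset.range m, h.choose i < 2 ^ m + F)
    (u w : Fin (2 ^ m + F) → Finset (Fin h)) (hu : Function.Injective u) (hw : Function.Injective w) :
    ∃ f ∈ SmallCircuits ℂ (h + h) 8,
      (Matrix.of fun i j : Fin (2 ^ m + F) => MvPolynomial.coeff
        (∑ a ∈ u i, Finsupp.single (Fin.castAdd h a) 1 +
          ∑ c ∈ w j, Finsupp.single (Fin.natAdd h c) 1) f).det ≠ 0 := by
  obtain ⟨A, hA, hsu⟩ := exists_shatters_of_card_gt u hu m hr
  obtain ⟨B, hB, hsw⟩ := exists_shatters_of_card_gt w hw m hr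
  exact partitionMinor_hit_of_shatters hh hK u w hu hw A B hA hB hsu hsw

end FullJoin

end

end Summit.ValiantsHypothesis.ValiantsHypothesis.Theorems.BarrierLever.HiddenStates
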